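import Mathlib
import Literature.Analysis.FluidPDE.WholeSpaceIBP
import HarnessLib

/-!
# Census row S7 (bounded steady flows in the periodic slab, case (d)): the localised energy
# identity of the linearised steady system

Support file for the scenario census of `NavierStokesRegularity` (cell `pub/ns-census`, row S7 =
Bang–Gui–Wang–Xie 2025, Thm 1.4 (d); tree FACT
`Literature.Analysis.FluidPDE.BangGuiWangXie2025_periodicSlab_liouville`, second conjunct). The
printed proof (arXiv:2205.13259, §5 Step 4, display after (6-1)) multiplies the differentiated
momentum equation `−Δ∂₃u + (∂₃u·∇)u + (u·∇)∂₃u + ∇∂₃P = 0` by `φ_R ∂₃u` and integrates by parts.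
Here is that computation for the abstract **linearised steady system**

  `ν Δw = (w·∇)U + (U·∇)w + ∇q`,  `div U = div w = 0`,

on a finite-dimensional real inner product space, tested against `Φ w` with `Φ ∈ C¹_c`
(`linearised_energy_identity`):

  `ν ∫ Φ |Dw|² = −ν Σᵢ ∫ (∂ᵢΦ) ⟪∂ᵢw, w⟫ + ½ ∫ (DΦ·U) ‖w‖² + ∫ (DΦ·w) ⟪U, w⟫`
  `             + ∫ Φ ⟪U, Dw(w)⟫ + ∫ q (DΦ·w)`,

with only FIRST derivatives of the test function on the right (so only gradient bounds of the
cut-off are needed downstream). Ingredients, all from the tree's `WholeSpaceIBP`: Green's first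
identity (`integral_inner_laplacian_add_eq_zero`), the trilinear identity
(`integral_inner_convect_add_eq_zero`, twice) and the pressure identity
(`integral_inner_gradient_eq_neg_integral_mul_divergence`); the template is the tree's steady
energy identity `IsLerayProfile.integral_mul_frobeniusNormSq_eq` (`SteadyNSLocalEnergy`).

No summit statement and no census row is proved in this file.

## References

* J. Bang, C. Gui, Y. Wang, C. Xie, J. Fluid Mech. 1005 (2025) A6 = arXiv:2205.13259, §5 Step 4
  (the identity after (6-1)). [BangGuiWangXie2025]
* G. Seregin, W. Wang, St. Petersburg Math. J. 31 (2020), proof of Prop. 2.1 (localised energy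
  identities for steady systems). [SereginWang2020]
-/

-- the summit and its single problem share the name (D-0017 nested layout)
set_option linter.dupNamespace false

noncomputable section

open MeasureTheory Set Function Filter InnerProductSpace
open scoped Topology RealInnerProductSpace Laplacian

namespace Summit.NavierStokesRegularity.NavierStokesRegularity.Theorems.ScenarioCensus.PeriodicSlab

open Literature.Analysis Literature.Analysis.FluidPDE

variable {E : Type*} [NormedAddCommGroup E] [InnerProductSpace ℝ E] [FiniteDimensional ℝ E]
  [MeasurableSpace E] [BorelSpace E]

/-- **The localised energy identity of the linearised steady system.** Let `U ∈ C¹`, `w ∈ C²`,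
`q ∈ C¹` on a finite-dimensional real inner product space with `div U = 0`, `div w = 0` and
`ν Δw = (w·∇)U + (U·∇)w + ∇q` pointwise, and let `Φ ∈ C¹_c`. Then, for any orthonormal basis `b`,
`ν ∫ Φ |Dw|² = −ν Σᵢ ∫ (∂ᵢΦ)⟪∂ᵢw, w⟫ + ½ ∫ (DΦ·U)‖w‖² + ∫ (DΦ·w)⟪U, w⟫ + ∫ Φ⟪U, Dw(w)⟫ + ∫ q (DΦ·w)`
(`|Dw|²` the Frobenius norm `frobeniusNormSq`). This is the identity displayed after (6-1) in
Bang–Gui–Wang–Xie, §5 Step 4 (there `U = u`, `w = ∂₃u`, `q = ∂₃P`, `ν = 1`, `Φ = φ_R`), with the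
Green term kept in first-order form. -/
theorem linearised_energy_identity {ι : Type*} [Fintype ι] (b : OrthonormalBasis ι ℝ E)
    {ν : ℝ} {U w : E → E} {q : E → ℝ} (hU : ContDiff ℝ 1 U) (hw : ContDiff ℝ 2 w)
    (hq : ContDiff ℝ 1 q) (hdivU : VectorCalculus.IsDivFree U) (hdivw : VectorCalculus.IsDivFree w)
    (hpde : ∀ x, ν • (Δ w) x = convect w U x + convect U w x + gradient q x)
    {Φ : E → ℝ} (hΦ : ContDiff ℝ 1 Φ) (hΦc : HasCompactSupport Φ) :
    ν * ∫ x, Φ x * frobeniusNormSq (fderiv ℝ w x) =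
      -(ν * ∑ i, ∫ x, fderiv ℝ Φ x (b i) * ⟪fderiv ℝ w x (b i), w x⟫) +
        2⁻¹ * (∫ x, fderiv ℝ Φ x (U x) * ‖w x‖ ^ 2) +
        (∫ x, fderiv ℝ Φ x (w x) * ⟪U x, w x⟫) +
        (∫ x, Φ x * ⟪U x, fderiv ℝ w x (w x)⟫) +
        ∫ x, q x * fderiv ℝ Φ x (w x) := by
  -- regularity
  have hw1 : ContDiff ℝ 1 w := hw.of_le one_le_two
  have hUd : ∀ x, DifferentiableAt ℝ U x := fun x => hU.differentiable one_ne_zero x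
  have hwd : ∀ x, DifferentiableAt ℝ w x := fun x => hw1.differentiable one_ne_zero x
  have hΦd : ∀ x, DifferentiableAt ℝ Φ x := fun x => hΦ.differentiable one_ne_zero x
  have hUc : Continuous U := hU.continuous
  have hwc : Continuous w := hw1.continuous
  have hqc : Continuous q := hq.continuous
  have hDwc : Continuous (fderiv ℝ w) := hw1.continuous_fderiv one_ne_zero
  have hΦcn : Continuous Φ := hΦ.continuous
  have hDΦc : Continuous (fderiv ℝ Φ) := hΦ.continuous_fderiv one_ne_zero
  -- the test field `W = Φ w`
  set W : E → E := fun x => Φ x • w x with hW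
  have hW1 : ContDiff ℝ 1 W := hΦ.smul hw1
  have hWc : HasCompactSupport W := hΦc.smul_right
  have hDΦcs : HasCompactSupport (fderiv ℝ Φ) := hΦc.fderiv (𝕜 := ℝ)
  have hDW : ∀ x v, fderiv ℝ W x v = fderiv ℝ Φ x v • w x + Φ x • fderiv ℝ w x v := fun x v => by
    rw [hW, fderiv_fun_smul (hΦd x) (hwd x)]
    simp [add_comm]
  -- (1) the equation tested against `W`
  have heq : ∀ x, ν * ⟪(Δ w) x, W x⟫ =
      Φ x * ⟪convect w U x, w x⟫ + Φ x * ⟪convect U w x, w x⟫ + Φ x * ⟪gradient q x, w x⟫ := by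
    intro x
    rw [← real_inner_smul_left, hpde x, hW]
    simp only [inner_add_left, real_inner_smul_right]
  -- (2) Green's identity for `v = w`, test `W`
  have green := FluidPDE.integral_inner_laplacian_add_eq_zero b hw hW1 (Or.inr hWc)
  have hpair : ∀ x, ∑ i, ⟪fderiv ℝ w x (b i), fderiv ℝ W x (b i)⟫ =
      (∑ i, fderiv ℝ Φ x (b i) * ⟪fderiv ℝ w x (b i), w x⟫) +
        Φ x * frobeniusNormSq (fderiv ℝ w x) := by
    intro x
    rw [frobeniusNormSq_eq_sum b, Finset.mul_sum, ← Finset.sum_add_distrib]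
    refine Finset.sum_congr rfl fun i _ => ?_
    rw [hDW x (b i), inner_add_right, real_inner_smul_right, real_inner_smul_right,
      real_inner_self_eq_norm_sq]
  -- (3) the trilinear identity with drift `U`
  have conv1 := FluidPDE.integral_inner_convect_add_eq_zero (F' := E) hU hw1 hW1 hWc
  have hconv1a : ∀ x, ⟪convect U w x, W x⟫ = Φ x * ⟪convect U w x, w x⟫ := fun x => by
    rw [hW, real_inner_smul_right]
  have hconv1b : ∀ x, ⟪w x, convect U W x⟫ =
      Φ x * ⟪convect U w x, w x⟫ + fderiv ℝ Φ x (U x) * ‖w x‖ ^ 2 := fun x => by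
    rw [hW, convect_smul_apply (hΦd x) (hwd x), inner_add_right, real_inner_smul_right,
      real_inner_smul_right, real_inner_self_eq_norm_sq, real_inner_comm]
  have hconv1c : ∫ x, VectorCalculus.divergence U x * ⟪w x, W x⟫ = 0 := by
    rw [← integral_zero (α := E) (G := ℝ)]
    refine integral_congr_ae (Eventually.of_forall fun x => ?_)
    show VectorCalculus.divergence U x * ⟪w x, W x⟫ = 0
    rw [hdivU x, zero_mul]
  -- (4) the trilinear identity with drift `w`
  have conv2 := FluidPDE.integral_inner_convect_add_eq_zero (F' := E) hw1 hU hW1 hWc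
  have hconv2a : ∀ x, ⟪convect w U x, W x⟫ = Φ x * ⟪convect w U x, w x⟫ := fun x => by
    rw [hW, real_inner_smul_right]
  have hconv2b : ∀ x, ⟪U x, convect w W x⟫ =
      Φ x * ⟪U x, fderiv ℝ w x (w x)⟫ + fderiv ℝ Φ x (w x) * ⟪U x, w x⟫ := fun x => by
    rw [hW, convect_smul_apply (hΦd x) (hwd x), inner_add_right, real_inner_smul_right,
      real_inner_smul_right, convect_apply]
  have hconv2c : ∫ x, VectorCalculus.divergence w x * ⟪U x, W x⟫ = 0 := by
    rw [← integral_zero (α := E) (G := ℝ)]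
    refine integral_congr_ae (Eventually.of_forall fun x => ?_)
    show VectorCalculus.divergence w x * ⟪U x, W x⟫ = 0
    rw [hdivw x, zero_mul]
  -- (5) the pressure identity
  have press := FluidPDE.integral_inner_gradient_eq_neg_integral_mul_divergence hq hW1 hWc
  have hdivW : ∀ x, VectorCalculus.divergence W x = fderiv ℝ Φ x (w x) := fun x => by
    rw [hW, divergence_smul_apply (hΦd x) (hwd x), hdivw x, mul_zero, zero_add, gradient,
      real_inner_comm, InnerProductSpace.toDual_symm_apply]
  have hpressa : ∀ x, ⟪gradient q x, W x⟫ = Φ x * ⟪gradient q x, w x⟫ := fun x => by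
    rw [hW, real_inner_smul_right]
  -- integrability of all the integrands (continuous, compactly supported)
  have hcsΦ : ∀ f : E → ℝ, HasCompactSupport fun x => Φ x * f x := fun f => hΦc.mul_right
  have hcsD : ∀ (v : E → E) (f : E → ℝ),
      HasCompactSupport fun x => fderiv ℝ Φ x (v x) * f x := fun v f =>
    hDΦcs.mono fun x hx => by
      rw [mem_support] at hx ⊢
      contrapose! hx
      simp [hx]
  have hconvUw : Continuous fun x => convect U w x := by
    simp only [convect_apply]; exact hDwc.clm_apply hUc
  have hconvwU : Continuous fun x => convect w U x := by
    simp only [convect_apply]; exact (hU.continuous_fderiv one_ne_zero).clm_apply hwc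
  have hI_A : Integrable (fun x => Φ x * ⟪convect U w x, w x⟫) :=
    (hΦcn.mul (hconvUw.inner hwc)).integrable_of_hasCompactSupport (hcsΦ _)
  have hI_B : Integrable (fun x => Φ x * ⟪convect w U x, w x⟫) :=
    (hΦcn.mul (hconvwU.inner hwc)).integrable_of_hasCompactSupport (hcsΦ _)
  have hI_P : Integrable (fun x => Φ x * ⟪gradient q x, w x⟫) :=
    (hΦcn.mul ((continuous_gradient_of_contDiff hq).inner hwc)).integrable_of_hasCompactSupport
      (hcsΦ _)
  have hFc : Continuous fun x => frobeniusNormSq (fderiv ℝ w x) := by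
    rw [show (fun x => frobeniusNormSq (fderiv ℝ w x)) =
      fun x => ∑ i, ‖fderiv ℝ w x (b i)‖ ^ 2 from funext fun x => frobeniusNormSq_eq_sum b _]
    exact continuous_finsetSum _ fun i _ => ((hDwc.clm_apply continuous_const).norm).pow 2
  have hI_F : Integrable (fun x => Φ x * frobeniusNormSq (fderiv ℝ w x)) :=
    (hΦcn.mul hFc).integrable_of_hasCompactSupport (hcsΦ _)
  have hI_S : ∀ i, Integrable (fun x => fderiv ℝ Φ x (b i) * ⟪fderiv ℝ w x (b i), w x⟫) :=
    fun i => (((hDΦc.clm_apply continuous_const).mul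
      ((hDwc.clm_apply continuous_const).inner hwc))).integrable_of_hasCompactSupport
        (hcsD (fun _ => b i) _)
  have hI_T : Integrable (fun x => fderiv ℝ Φ x (U x) * ‖w x‖ ^ 2) :=
    (((hDΦc.clm_apply hUc).mul (hwc.norm.pow 2))).integrable_of_hasCompactSupport (hcsD U _)
  have hI_R : Integrable (fun x => fderiv ℝ Φ x (w x) * ⟪U x, w x⟫) :=
    (((hDΦc.clm_apply hwc).mul (hUc.inner hwc))).integrable_of_hasCompactSupport (hcsD w _)
  have hI_Q : Integrable (fun x => Φ x * ⟪U x, fderiv ℝ w x (w x)⟫) :=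
    (hΦcn.mul (hUc.inner (hDwc.clm_apply hwc))).integrable_of_hasCompactSupport (hcsΦ _)
  -- assemble: rewrite every pairing
  have e1' : ν * ∫ x, ⟪(Δ w) x, W x⟫ = (∫ x, Φ x * ⟪convect w U x, w x⟫) +
      (∫ x, Φ x * ⟪convect U w x, w x⟫) + ∫ x, Φ x * ⟪gradient q x, w x⟫ := by
    rw [← integral_const_mul, ← integral_add hI_B hI_A,
      ← integral_add (f := fun x => Φ x * ⟪convect w U x, w x⟫ + Φ x * ⟪convect U w x, w x⟫)
        (hI_B.add hI_A) hI_P]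
    exact integral_congr_ae (Eventually.of_forall heq)
  have e2 : ∑ i, ∫ x, ⟪fderiv ℝ w x (b i), fderiv ℝ W x (b i)⟫ =
      (∑ i, ∫ x, fderiv ℝ Φ x (b i) * ⟪fderiv ℝ w x (b i), w x⟫) +
        ∫ x, Φ x * frobeniusNormSq (fderiv ℝ w x) := by
    rw [← integral_finsetSum _ fun i _ => hI_S i, ← integral_add (integrable_finsetSum _
      fun i _ => hI_S i) hI_F]
    have : ∀ i, Integrable (fun x => ⟪fderiv ℝ w x (b i), fderiv ℝ W x (b i)⟫) := fun i => by
      have : (fun x => ⟪fderiv ℝ w x (b i), fderiv ℝ W x (b i)⟫) = fun x =>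
          fderiv ℝ Φ x (b i) * ⟪fderiv ℝ w x (b i), w x⟫ + Φ x * ‖fderiv ℝ w x (b i)‖ ^ 2 := by
        funext x
        rw [hDW x (b i), inner_add_right, real_inner_smul_right, real_inner_smul_right,
          real_inner_self_eq_norm_sq]
      rw [this]
      exact (hI_S i).add (((hΦcn.mul ((hDwc.clm_apply continuous_const).norm.pow 2)))
        |>.integrable_of_hasCompactSupport (hcsΦ _))
    rw [← integral_finsetSum _ fun i _ => this i]
    exact integral_congr_ae (Eventually.of_forall fun x => hpair x)
  have e3 : ∫ x, ⟪convect U w x, W x⟫ = ∫ x, Φ x * ⟪convect U w x, w x⟫ :=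
    integral_congr_ae (Eventually.of_forall hconv1a)
  have e4 : ∫ x, ⟪w x, convect U W x⟫ = (∫ x, Φ x * ⟪convect U w x, w x⟫) +
      ∫ x, fderiv ℝ Φ x (U x) * ‖w x‖ ^ 2 := by
    rw [← integral_add hI_A hI_T]
    exact integral_congr_ae (Eventually.of_forall hconv1b)
  have e5 : ∫ x, ⟪convect w U x, W x⟫ = ∫ x, Φ x * ⟪convect w U x, w x⟫ :=
    integral_congr_ae (Eventually.of_forall hconv2a)
  have e6 : ∫ x, ⟪U x, convect w W x⟫ = (∫ x, Φ x * ⟪U x, fderiv ℝ w x (w x)⟫) +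
      ∫ x, fderiv ℝ Φ x (w x) * ⟪U x, w x⟫ := by
    rw [← integral_add hI_Q hI_R]
    exact integral_congr_ae (Eventually.of_forall hconv2b)
  have e7 : ∫ x, ⟪gradient q x, W x⟫ = ∫ x, Φ x * ⟪gradient q x, w x⟫ :=
    integral_congr_ae (Eventually.of_forall hpressa)
  have e8 : ∫ x, q x * VectorCalculus.divergence W x = ∫ x, q x * fderiv ℝ Φ x (w x) :=
    integral_congr_ae (Eventually.of_forall fun x => by
      show q x * VectorCalculus.divergence W x = q x * fderiv ℝ Φ x (w x)
      rw [hdivW x])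
  -- Green's identity multiplied by `ν`
  have green' : ν * (∫ x, ⟪(Δ w) x, W x⟫) +
      ν * ∑ i, ∫ x, ⟪fderiv ℝ w x (b i), fderiv ℝ W x (b i)⟫ = 0 := by
    rw [← mul_add, green, mul_zero]
  rw [e1', e2] at green'
  rw [e3, e4, hconv1c] at conv1
  rw [e5, e6, hconv2c] at conv2
  rw [e7, e8] at press
  linarith [green', conv1, conv2, press]

end Summit.NavierStokesRegularity.NavierStokesRegularity.Theorems.ScenarioCensus.PeriodicSlab

end
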